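import Summits.HodgeConjecture.HodgeConjecture.Theses.HeckePrymWeil
import Summits.HodgeConjecture.HodgeConjecture.Theorems.WeilTwelvefoldsSqrtMinus7.Negative.EigenvalueTyping
import Summits.HodgeConjecture.HodgeConjecture.Theorems.WeilTwelvefoldsSqrtMinus7.Negative.WeilPlaneReality
import Literature.AlgebraicGeometry.Motives.AbelianVarietyProduct
import Literature.AlgebraicGeometry.HodgeTheory.SemiregularVariationalHodge
import Literature.AlgebraicGeometry.HodgeTheory.MotivatedClasses
import Literature.AlgebraicGeometry.HodgeTheory.HodgeConjectureQbarVoisinProofs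
import HarnessLib
import HarnessLib.Audit

/-!
# Line `polya-glued-box-products` — skeleton for crux `HeckePrymWeil.WeilTwelvefoldsSqrtMinus7`
(item stmt-HodgeConjecture-1261, route route-HodgeConjecture-HeckePrymWeil; crux-plan, planner
`planner-cruxplan-stmt-HodgeConjecture-1261-polya-glued-box-prod-0`, 2026-08-16)

Crux (FIXED, the route's single-operator typing): on every complex abelian 12-fold `A` with
`φ ≫ φ = -7` every rational `(6,6)`-class of the Weil span
`Eig((𝟙+φ)^*, (1+i√7)¹²) ⊔ Eig((𝟙+φ)^*, (1-i√7)¹²) ⊆ H¹²(A(ℂ); ℂ)` is algebraic — ALL discriminants.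

Idea (crux idea card `Cruxes/WeilTwelvefoldsSqrtMinus7/Ideas/polya-glued-box-products.md`, rev. 2;
triage r1: FAIL (k=1, repaired) / PASS / PASS): at a PRODUCT ANCHOR `P = W₁ × W₂ × W₃` of three
`ℚ(√-7)`-Weil FOURFOLDS (all settled: Markman 2025, every discriminant, so `δ(P) = δ₁δ₂δ₃` reaches
every component `𝓗_{12,δ}`) manufacture an honest VECTOR BUNDLE whose Chern character is
`ch = R·e^{h} + c·w₊₊₊ + c̄·w₋₋₋` (`c ≠ 0`; the triage repair of r1-1/r1-2: the polarisation powers are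
KEPT, only the mixed Künneth tensors are killed) by (P) factorwise purification in `K₀(Wᵢ)`,
(Π) PÓLYA CANCELLATION — twist the factors by powers `k^{eᵢ j}` of `k = 1 + φ` with exponent vector
`e = (1,2,4)` and take the direct sum `⊕ⱼ G_j^{⊕ n_j}` with NON-NEGATIVE multiplicities `n ∈ ℕ[x]`
annihilating the 24 bad characters `μ_ε = σ(k)^{4a} σ̄(k)^{4b}`, `a ≠ b` (non-real by the landed
`Negative.one_add_I_sqrt7_pow_ne`; Poincaré 1883 / Pólya 1928 positive-multiplier theorem) — and
(Γ) GLUE the polystable sum to a simple bundle `𝒢` in the same class; then Buchweitz–Flenner /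
Pridham / Perry semiregular deformation spreads `ch₆` over the whole 36-dimensional polarised Weil
component, and isogeny + the `(𝟙+φ)^*`-eigenvalue trick give the crux.

TYPING DECISION (planner, recorded in the line card §Disproof/§Triage): the tree has NO real carrier
for the full Buchweitz–Flenner semiregularity map (`σ_q`, `q ≥ 2`: no `Ω^q`, `defn-HodgeSheavesOmega`
pending; the decorated `SemiregularityData` typing is vacuous/refutable —
`SemiregularSeedsOnAnchors/Negative/SemiregularityCarrier`), and the real `{0,1}`-semiregularity
(`IsZeroOneSemiregular`) is MATHEMATICALLY EXCLUDED here: for each of the 42 polarised non-Weil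
directions `ξ`, `ob(ξ) = ⟨ξ, At 𝒢⟩ ≠ 0` (`σ₅(ob ξ) = ξ ⌟ ch₆ = ξ ⌟ W ≠ 0`) while
`σ₀(ob ξ) = R·ξ⌟h = 0` and `σ₁(ob ξ) = (R/2)·ξ⌟h² = 0` (BF Prop. 4.2).  Hence semiregularity is NOT a
typed intermediate of this skeleton: the bet is stated at the OBJECT-EXTENSION level it buys
(`stub_gluedBundleExtends`: a same-Chern-character replacement of the Pólya bundle extends to a
vector bundle over a dominant base change of every smooth family along which its Chern character
stays Hodge — the output of BF §7 / Pridham / Perry Thm 1.1 (1)), and everything downstream is at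
CLASS level on real carriers.  A definition request for the full `σ` is filed with the crux item.

The seven registered stubs (signatures over existing Literature / Mathlib declarations only; local
NOTATIONS, no local definitions; the Weil span always in the ROUTE's single-operator typing):

* `stub_polyaMultiplier` (M, provable now) — Poincaré–Pólya: `q > 0` on `[0, ∞)` ⟹ `(1+X)^N q ∈ ℝ_{≥0}[X]`.
* `stub_weilFourfoldsTyped` (M/L) — Markman 2025 (all discriminants) for `K = ℚ(√-7)` fourfolds in
  the route's typing (named fact `Markman2025_weilClasses_algebraic_abelianFourfold` + `H⁴ = ⋀⁴H¹`).
* `stub_polyaBundle` (L; GIVEN the two above) — (P)+(Π) as an honest finite locally free sheaf on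
  every product anchor: CLEAN Chern data (`ch_k = R hᵏ/k!`, `k ≠ 6`; `ch₆ = R h⁶/6! + v₊ + v₋`) with
  NON-DEGENERATE Weil part (`v± ≠ 0` in the two typed eigenspaces, `v₊ + v₋` rational).
* `stub_gluedBundleExtends` (THE BET, XL/open; = (Γ) + semiregular deformation) — see above.
* `stub_productAnchoredFamilies` (reach; classical, XL in Lean) — a Chern character theory on the real
  carrier exists, and every Weil-type `(A, φ)` is `K`-isogenous to a fibre of a smooth projective
  family over a smooth irreducible quasi-projective base through a product anchor, carrying flat
  Hodge sections through any clean Chern data, with non-degenerate typed Weil part at that fibre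
  (Landherr + van Geemen §5 + PEL universal families with level `N ≥ 3` + `det`-trivial monodromy).
* `stub_algebraicitySpreads` (classical, L/XL) — a flat class which is `ch_p` of a vector bundle on a
  dominant base change is algebraic on EVERY fibre (Chow schemes, countability, Baire).
* `stub_typedPlaneTransfer` (L) — typed Weil LINES (`H¹² = ⋀¹²H¹`, `mixed_twelve`), eigenvalue
  separation `λ ≠ λ̄` (landed `weilEigenvalues_twelve_ne`) and `[m]^* = m¹²`: one algebraic class with
  both typed components non-zero on a `K`-isogenous `A″` makes the whole typed plane of `A` algebraic.

The seven statements are the named `Prop`s `PolyaMultiplier`, …, `TypedPlaneTransfer`; the registered stubs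
are `theorem stub_<name> : <Name> := by sorry` (the ONLY sorries); `Registered.stub_<name>` are their
name-keyed aliases; `WeilTwelvefoldsSqrtMinus7_of` takes exactly those seven as hypotheses (closed,
sorry-free) and concludes the crux BY NAME; `WeilTwelvefoldsSqrtMinus7_of_stubs` feeds it the stubs.

Disproof used (Disproof.lean cycles 1–2, NO KILL; landed Negative files imported above):
`_false_without_` analysis §2 — only `IsOfHodgeType` is load-bearing: honoured at
`stub_productAnchoredFamilies` (the Weil witness `c ≠ 0` of type `(6,6)` is what puts `A` on a
`(6,6)` PEL component) and inside `stub_gluedBundleExtends` (the bundle extends only where `ch`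
stays Hodge); §6 reality / `components_mem_span_pair` / `weilEigenvalues_twelve_ne` — literally the
algebra of `stub_typedPlaneTransfer`; §1 `one_add_I_sqrt7_pow_ne (4|a-b|)` — non-reality of the bad
Pólya characters inside `stub_polyaBundle`; `phiStar_does_not_separate` — the twist is by `1+φ`, not
`φ`; `pitfall_pullback_not_additive_doc` — characters computed as `⋀` of the degree-1 action.
No stub is an instance of a landed Negative lemma (`onlyPlus/MinusVariant` vacuity: every stub keeps
the `⊔`; `SemiregularityCarrier`: no decorated semiregularity occurs).  Negatives index (11121,
12555): unrelated.
-/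

noncomputable section

set_option linter.dupNamespace false

open CategoryTheory AlgebraicGeometry
open Literature.AlgebraicGeometry Literature.AlgebraicGeometry.Motives
  Literature.AlgebraicGeometry.HodgeTheory Literature.AlgebraicTopology.SingularHomology

namespace Summit.HodgeConjecture.HodgeConjecture.Cruxes.WeilTwelvefoldsSqrtMinus7.PolyaGluedBoxProducts

/-! ### Local notations (no declarations) -/

/-- `EigP[X, ψ, k]` — the `+` typed Weil eigenspace `Eig((𝟙+ψ)^*, (1+i√7)ᵏ) ⊆ Hᵏ(X(ℂ); ℂ)` of the
abelian variety `X` with endomorphism `ψ` (the ROUTE's single-operator typing, verbatim). -/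
local notation3 (prettyPrint := false) "EigP[" Av ", " ψ ", " k "]" =>
  Module.End.eigenspace (complexBetti.map (𝟙 Av + ψ).hom.hom.hom k).hom
    ((1 + Complex.I * (Real.sqrt (7 : ℝ) : ℂ)) ^ k)

/-- `EigM[X, ψ, k]` — the `-` typed Weil eigenspace `Eig((𝟙+ψ)^*, (1-i√7)ᵏ)`. -/
local notation3 (prettyPrint := false) "EigM[" Av ", " ψ ", " k "]" =>
  Module.End.eigenspace (complexBetti.map (𝟙 Av + ψ).hom.hom.hom k).hom
    ((1 - Complex.I * (Real.sqrt (7 : ℝ) : ℂ)) ^ k)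

/-- `Witness[X, ψ, k, p]` — `(X, ψ)` is of Weil type, witnessed as the crux supplies it: a NON-ZERO
rational class of Hodge type `(p, p)` in the typed Weil span in degree `k = 2p = dim X`. -/
local notation3 (prettyPrint := false) "Witness[" Av ", " ψ ", " k ", " p "]" =>
  (∃ u : complexBetti (AbelianVariety.X Av) k, u ≠ 0 ∧ IsRationalClass u ∧
    IsOfHodgeType k (AbelianVariety.X Av) k p p u ∧ u ∈ EigP[Av, ψ, k] ⊔ EigM[Av, ψ, k])

/-- `Fourfold[C, W, ψ, L, h]` — a factor of a product anchor: a complex abelian FOURFOLD `W` with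
`ψ ≫ ψ = -7`, of Weil type `(2,2)` (witnessed), with an invertible module `L` (finite locally free of
rank `≤ 1`) whose first Chern character `h = ch₁(L)` (in the theory `C`) is a `ψ`-compatible
polarisation class (`IsPolarizationClass`: rational, divisorial, hard Lefschetz; `ψ^* h = 7 h`,
i.e. `E(√-7 x, √-7 y) = 7 E(x, y)`, van Geemen 5.2). -/
local notation3 (prettyPrint := false) "Fourfold[" C ", " W ", " ψ ", " L ", " h "]" =>
  (AbelianVariety.dim W = 4 ∧ ψ ≫ ψ = -((7 : ℤ) • 𝟙 W) ∧ Witness[W, ψ, 4, 2] ∧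
    IsFiniteLocallyFree L ∧ HasRankLE L 1 ∧ ChernCharacterBetti.ch C (AbelianVariety.X W) L 1 = h ∧
    IsPolarizationClass 4 (AbelianVariety.X W) h ∧
    complexBetti.map (ψ).hom.hom.hom 2 h = (7 : ℂ) • h)

/-- `P3[W₁, W₂, W₃]` — the product anchor `W₁ × (W₂ × W₃)` as an abelian variety. -/
local notation3 (prettyPrint := false) "P3[" W₁ ", " W₂ ", " W₃ "]" =>
  AbelianVariety.prod W₁ (AbelianVariety.prod W₂ W₃)

/-- `E3[W₁, W₂, W₃, ψ₁, ψ₂, ψ₃]` — the product endomorphism `ψ₁ × ψ₂ × ψ₃` of `P3[W₁, W₂, W₃]`. -/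
local notation3 (prettyPrint := false) "E3[" W₁ ", " W₂ ", " W₃ ", " ψ₁ ", " ψ₂ ", " ψ₃ "]" =>
  AbelianVariety.prodLift (AbelianVariety.fst W₁ (AbelianVariety.prod W₂ W₃) ≫ ψ₁)
    (AbelianVariety.snd W₁ (AbelianVariety.prod W₂ W₃) ≫
      AbelianVariety.prodLift (AbelianVariety.fst W₂ W₃ ≫ ψ₂) (AbelianVariety.snd W₂ W₃ ≫ ψ₃))

/-- `H3[W₁, W₂, W₃, h₁, h₂, h₃]` — the product polarisation class `pr₁^*h₁ + pr₂^*h₂ + pr₃^*h₃`. -/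
local notation3 (prettyPrint := false) "H3[" W₁ ", " W₂ ", " W₃ ", " h₁ ", " h₂ ", " h₃ "]" =>
  (complexBetti.map (AbelianVariety.fst W₁ (AbelianVariety.prod W₂ W₃)).hom.hom.hom 2 h₁ +
    complexBetti.map (AbelianVariety.snd W₁ (AbelianVariety.prod W₂ W₃)).hom.hom.hom 2
      (complexBetti.map (AbelianVariety.fst W₂ W₃).hom.hom.hom 2 h₂ +
        complexBetti.map (AbelianVariety.snd W₂ W₃).hom.hom.hom 2 h₃))

/-- `Clean[C, X, ψ, h, E, R]` — **clean Chern data with non-degenerate Weil part** for a module `E`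
on the abelian 12-fold `X` (intended: the product anchor) relative to the endomorphism `ψ`, the
polarisation class `h` and the rank `R`: `ch_k(E) = (R/k!) hᵏ` for `k ≠ 6` and
`ch₆(E) = (R/6!) h⁶ + v₊ + v₋` with `v₊ ∈ Eig((𝟙+ψ)^*, (1+i√7)¹²)`, `v₋ ∈ Eig((𝟙+ψ)^*, (1-i√7)¹²)`
BOTH NON-ZERO and `v₊ + v₋` rational — i.e. `ch(E) = R·e^{h} + c·w₊ + c̄·w₋`, `c ≠ 0`: exactly the
flat-Hodge span of the polarised Weil component (Weil 1977 / van Geemen 6.12: `B* = ℚ[h] ⊕ W` on the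
general member), the output of the Pólya cancellation after the triage repair (polarisation powers
kept). -/
local notation3 (prettyPrint := false) "Clean[" C ", " Av ", " ψ ", " h ", " E ", " R "]" =>
  ((∀ k : ℕ, k ≠ 6 → ChernCharacterBetti.ch C (AbelianVariety.X Av) E k =
      ((R : ℂ) * (((Nat.factorial k : ℕ) : ℂ))⁻¹) • cupPowTwo h k) ∧
    ∃ vp vm : complexBetti (AbelianVariety.X Av) 12, vp ∈ EigP[Av, ψ, 12] ∧ vm ∈ EigM[Av, ψ, 12] ∧
      vp ≠ 0 ∧ vm ≠ 0 ∧ IsRationalClass (vp + vm) ∧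
      ChernCharacterBetti.ch C (AbelianVariety.X Av) E 6 =
        ((R : ℂ) * (((Nat.factorial 6 : ℕ) : ℂ))⁻¹) • cupPowTwo h 6 + (vp + vm))

/-- `Family[f, B]` — `f : 𝒳 ⟶ B` is a smooth projective family of 12-folds over a smooth,
irreducible, quasi-projective complex base (the shape of the universal PEL family with level
structure, and of the bases Buchweitz–Flenner / Perry deform over). -/
local notation3 (prettyPrint := false) "Family[" f ", " B "]" =>
  (IsSmoothProjectiveFamily f 12 ∧ IsQuasiProjectiveOver B ∧ IsIntegral (B).left ∧
    _root_.AlgebraicGeometry.Smooth (B).hom)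

/-- `FlatHodge[f, τ]` — `τ k` (`k : ℕ`) are CONTINUOUS (= flat) sections of the étalé spaces
`FiberClass f (2k)` of `R^{2k} f_* ℂ` with values rational `(k,k)`-classes ("`ch` remains Hodge along
the base", Perry Thm 1.1; CDK locus of Hodge classes). -/
local notation3 (prettyPrint := false) "FlatHodge[" f ", " τ "]" =>
  ((∀ k : ℕ, Continuous fun s => (⟨s, τ k s⟩ : FiberClass f (2 * k))) ∧
    ∀ (k : ℕ) s, (⟨s, τ k s⟩ : FiberClass f (2 * k)) ∈ locusOfHodgeClasses f 12 k)

/-! ### The seven statements (named `Prop`s; the registered stubs `stub_*` below prove them by `sorry`) -/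

/-- **Statement 1 (`stub_polyaMultiplier`) — Poincaré–Pólya positive multiplier (the arithmetic engine of move (Π); provable now,
not in Mathlib).** A real polynomial positive on `[0, ∞)` becomes coefficientwise non-negative after
multiplication by a power of `1 + X` (Poincaré 1883; Pólya 1928 "Über positive Darstellung von
Polynomen"; Hardy–Littlewood–Pólya §2.24; proof: homogenise to a form positive on the closed simplex,
or induct on the number of non-real root pairs).  Used with `q = ∏_ε (X - μ_ε)(X - μ̄_ε)` over the 12
conjugate pairs of BAD characters `μ_ε = σ(k)^{4a} σ̄(k)^{4b}`, `a ≠ b` (non-real: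
`Negative.one_add_I_sqrt7_pow_ne (4|a-b|)`), so that `n = (1+X)^N q ∈ ℕ[X]` gives honest direct-sum
multiplicities `n_j`.  NB (triage r1-3): the prose form "non-real algebraic ⇒ minimal polynomial has no
root in `[0,∞)`" is false (`i·2^{1/4}`); this typed form is the true statement. [informal size M] -/
def PolyaMultiplier : Prop :=
  ∀ q : Polynomial ℝ, (∀ x : ℝ, 0 ≤ x → 0 < q.eval x) →
    ∃ N : ℕ, ∀ i : ℕ, 0 ≤ (((1 : Polynomial ℝ) + Polynomial.X) ^ N * q).coeff i

/-- **Statement 2 (`stub_weilFourfoldsTyped`) — Markman 2025 for `K = ℚ(√-7)` fourfolds, in the ROUTE's typing.** On every complex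
abelian fourfold `W` with `ψ ≫ ψ = -7`, every rational `(2,2)`-class of the typed Weil span
`Eig((𝟙+ψ)^*, (1+i√7)⁴) ⊔ Eig((𝟙+ψ)^*, (1-i√7)⁴) ⊆ H⁴(W(ℂ); ℂ)` is algebraic — all discriminants
(Markman, arXiv:2509.23403 Thm 1.2 / §11.5 Step 2; arXiv:2502.03415 Cor. 1.6.1).  In the tree this is the
NAMED FACT `Markman2025_weilClasses_algebraic_abelianFourfold` (typed over the simultaneous
eigenclasses `weilClassesOf W ψ 2 7`) plus the typing bridge "single-operator eigenspace of `(𝟙+ψ)^*`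
for `(1±i√7)⁴` = `⋀⁴V_±`" (`H⁴ = ⋀⁴H¹` on carriers + `Negative.mixed_eq_plus_iff`) and
`AbelianVariety.isSmoothProjective_holds`.  Input of (P): it makes the factor Weil classes `wᵢ` cycle
classes, hence Chern characters. [informal size M/L; the fact itself is a published theorem] -/
def WeilFourfoldsTyped : Prop :=
  ∀ (W : AbelianVariety ℂ) (ψ : W ⟶ W), W.dim = 4 → ψ ≫ ψ = -((7 : ℤ) • 𝟙 W) →
  ∀ c : complexBetti W.X 4, IsRationalClass c → IsOfHodgeType 4 W.X 4 2 2 c →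
    c ∈ EigP[W, ψ, 4] ⊔ EigM[W, ψ, 4] → c ∈ algebraicClasses W.X 2

/-- **Statement 3 (`stub_polyaBundle`) — the Pólya bundle: moves (P) + (Π) as an HONEST VECTOR BUNDLE on every product anchor,
GIVEN Stubs 1 and 2.** For every Chern character theory `C` on the real carrier and every product
anchor `P = W₁ × W₂ × W₃` of `ℚ(√-7)`-Weil fourfolds `(Wᵢ, ψᵢ)` with invertible modules `Lᵢ`,
`hᵢ = ch₁(Lᵢ)` compatible polarisation classes, there is a finite locally free `F` on `P` of some rank
`R > 0` with CLEAN Chern data relative to (`ψ₁×ψ₂×ψ₃`, `h = Σ prᵢ^* hᵢ`) and NON-DEGENERATE Weil part.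
Intended proof (card + triage r1-2 repair): (P) in `K₀(Wᵢ)`: `wᵢ` is algebraic (Stub 2), hence
`bᵢ wᵢ = ch(yᵢ)` for a virtual class purified degree by degree with the pull-backs `[m]^*`
(`[m]^* = m^{2k}` on `H^{2k}`); `ξᵢ = rᵢ[Lᵢ] + yᵢ` with `rᵢ ≥ 4` is the class of a vector bundle `Fᵢ`
(general sections: rank `≥ dim`), `ch(Fᵢ) = rᵢ e^{hᵢ} + bᵢ wᵢ`, `bᵢ ≠ 0`; (Π) `k = 1 + ψ`,
`k^* hᵢ = 8 hᵢ`, `k^* wᵢ± = (1 ± i√7)⁴ wᵢ±`, `wᵢ ∪ hᵢ = 0`, `e = (1,2,4)`,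
`G_j = ⊠ᵢ ((k^{eᵢ j})^*Fᵢ ⊗ Lᵢ^{1-8^{eᵢ j}})` has `ch(G_j) = ⊠ᵢ (rᵢ e^{hᵢ} + bᵢ σ^{4eᵢj} wᵢ₊ + bᵢ σ̄^{4eᵢj} wᵢ₋)`;
the coefficient of the Künneth tensor `T_ε` in `ch(⊕ G_j^{n_j})` is `C_ε n(μ_ε)`, and Stub 1 gives
`n ∈ ℕ[X]` with `n(μ_ε) = 0` for the 24 bad `ε` (distinct binary subset sums ⇒ `a ≠ b` ⇒ `μ_ε`
non-real), `n(1) > 0`, `n(σ^{28}) ≠ 0` (modulus `8^{14}` + `weilEigenvalue_pow_ne`): so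
`F = ⊕ G_j^{n_j}` has `ch F = R e^{h} + c w₊₊₊ + c̄ w₋₋₋`, `R = r₁r₂r₃ n(1)`, `c = b₁b₂b₃ n(σ^{28}) ≠ 0`.
Cheapest falsifier: the `n = 2` toy (`S₁ × S₂`, line bundles on abelian surfaces). [informal size L] -/
def PolyaBundle : Prop :=
  PolyaMultiplier → WeilFourfoldsTyped →
  ∀ (C : ChernCharacterBetti) (W₁ W₂ W₃ : AbelianVariety ℂ) (ψ₁ : W₁ ⟶ W₁) (ψ₂ : W₂ ⟶ W₂)
    (ψ₃ : W₃ ⟶ W₃) (L₁ : W₁.X.left.Modules) (L₂ : W₂.X.left.Modules) (L₃ : W₃.X.left.Modules)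
    (h₁ : complexBetti W₁.X 2) (h₂ : complexBetti W₂.X 2) (h₃ : complexBetti W₃.X 2),
    Fourfold[C, W₁, ψ₁, L₁, h₁] → Fourfold[C, W₂, ψ₂, L₂, h₂] → Fourfold[C, W₃, ψ₃, L₃, h₃] →
    ∃ (F : (P3[W₁, W₂, W₃]).X.left.Modules) (_ : IsFiniteLocallyFree F) (R : ℕ), 0 < R ∧
      Clean[C, P3[W₁, W₂, W₃], E3[W₁, W₂, W₃, ψ₁, ψ₂, ψ₃], H3[W₁, W₂, W₃, h₁, h₂, h₃], F, R]

/-- **Statement 4 (`stub_gluedBundleExtends`) — THE BET: the glued Pólya bundle extends (move (Γ) + semiregular deformation;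
HARDEST, load-bearing).** For every product anchor `P` (as in Stub 3), every finite locally free `F`
on `P` with clean non-degenerate Chern data, every smooth projective family `f : 𝒳 ⟶ B` of 12-folds
over a smooth irreducible quasi-projective base, every point `b₀` with `𝒳_{b₀} ≅ P` and every system
of flat Hodge sections `τ k` through `ch_k(F)` at `b₀` (i.e. `ch(F)` "remains Hodge along `B`"), there
are a DOMINANT base change `g : V ⟶ B` (`V` smooth, irreducible, quasi-projective; `𝒳' = 𝒳 ×_B V`),
a point `v₀` over `b₀`, and a finite locally free `𝓖` on the TOTAL SPACE `𝒳'` whose restriction to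
the fibre over `v₀` has, in every degree, the Chern character `τ k (g v₀)` = that of `F` — a
same-Chern-character replacement `𝒢 = 𝓖|_{𝒳'_{v₀}}` of `F` that EXTENDS over an étale-local piece of
the family.  Intended proof (the line): `𝒢` := a generic point of the deformation space of the
polystable `F` (non-split iterated extensions: `Hom` between the twisted factors is
`H⁰(O((8^{j'}-8^{j})mΘ)) ≠ 0`, the Weil parts supply `Ext¹`) or an elementary transformation along a
theta divisor, SIMPLE; show it is SEMIREGULAR (Buchweitz–Flenner `σ : Ext²(𝒢,𝒢) → ⊕_q H^{q+2}(Ω^q)`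
injective; target dimension `Σ_q h^{q,q+2} = C(24,10) = 1 961 256`; `σ₀, σ₁` alone CANNOT suffice, see
the module docstring); then BF §7 / Pridham / Perry Thm 1.1 (1) deform `𝒢` over the formal, hence
(Artin) an étale neighbourhood of `b₀` in the Hodge locus of `ch 𝒢` = all of `B`, as an honest sheaf
(`c₁ = R h` stays `(1,1)`, no gerbe), locally free by openness.  Why it might fail: AMNESIA
(the glued object may remember the product structure and stay obstructed in the 24 transverse
directions although `ch` stays Hodge — census B4, razor R of TRIAGE r1-2); and
`χ(𝒢,𝒢) = 2|c|² ∫ w₊ ∧ w̄₊ > 0` is astronomically large for Pólya multiplicities (TRIAGE r1-1), so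
`ext⁴ + ext⁶` must carry it while `ext²` stays below the budget.  Relation to the crux: with Stubs 5–7
it implies the crux on the component of `P`, and generic algebraicity of the Weil classes on that
component implies it back modulo `K`-theory — it is the line's `C⁺` made object-level. [informal size XL; open] -/
def GluedBundleExtends : Prop :=
  ∀ (C : ChernCharacterBetti) (W₁ W₂ W₃ : AbelianVariety ℂ) (ψ₁ : W₁ ⟶ W₁) (ψ₂ : W₂ ⟶ W₂)
      (ψ₃ : W₃ ⟶ W₃) (L₁ : W₁.X.left.Modules) (L₂ : W₂.X.left.Modules) (L₃ : W₃.X.left.Modules)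
      (h₁ : complexBetti W₁.X 2) (h₂ : complexBetti W₂.X 2) (h₃ : complexBetti W₃.X 2),
      Fourfold[C, W₁, ψ₁, L₁, h₁] → Fourfold[C, W₂, ψ₂, L₂, h₂] → Fourfold[C, W₃, ψ₃, L₃, h₃] →
    ∀ (F : (P3[W₁, W₂, W₃]).X.left.Modules) (_ : IsFiniteLocallyFree F) (R : ℕ),
      Clean[C, P3[W₁, W₂, W₃], E3[W₁, W₂, W₃, ψ₁, ψ₂, ψ₃], H3[W₁, W₂, W₃, h₁, h₂, h₃], F, R] →
    ∀ (𝒳 B : SchemeOver ℂ) (f : 𝒳 ⟶ B), Family[f, B] →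
    ∀ (b₀ : ComplexPoints B) (e₀ : fiberOver f b₀ ≅ (P3[W₁, W₂, W₃]).X)
      (τ : ∀ (k : ℕ) (s : ComplexPoints B), complexBetti (fiberOver f s) (2 * k)),
      FlatHodge[f, τ] →
      (∀ k : ℕ, τ k b₀ = complexBetti.map e₀.hom (2 * k)
        (ChernCharacterBetti.ch C (P3[W₁, W₂, W₃]).X F k)) →
    ∃ (V 𝒳' : SchemeOver ℂ) (g : V ⟶ B) (f' : 𝒳' ⟶ V) (G : 𝒳' ⟶ 𝒳),
      IsQuasiProjectiveOver V ∧ IsIntegral V.left ∧ _root_.AlgebraicGeometry.Smooth V.hom ∧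
      IsDominant g.left ∧ IsPullback G f' f g ∧ IsSmoothProjectiveFamily f' 12 ∧
      ∃ (e : ∀ v : ComplexPoints V, fiberOver f' v ≅ fiberOver f (v ≫ g))
        (v₀ : ComplexPoints V) (𝓖 : 𝒳'.left.Modules) (_ : IsFiniteLocallyFree 𝓖),
        (∀ v, (e v).hom ≫ fiberι f (v ≫ g) = fiberι f' v ≫ G) ∧ v₀ ≫ g = b₀ ∧
        ∀ k : ℕ, ChernCharacterBetti.ch C (fiberOver f' v₀)
            ((Scheme.Modules.pullback (fiberι f' v₀).left).obj 𝓖) k =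
          complexBetti.map (e v₀).hom (2 * k) (τ k (v₀ ≫ g))

/-- **Statement 5 (`stub_productAnchoredFamilies`) — product-anchored polarised Weil families reach every Weil 12-fold up to isogeny
(classical; XL in Lean).** There is a Chern character theory `C` on the real carrier (the topological
Chern character: intended instance of the hypothesis structure `ChernCharacterBetti`, D-0026) such
that: for every complex abelian 12-fold `(A, φ)` with `φ ≫ φ = -7` of Weil type `(6,6)` (witnessed by a
non-zero rational `(6,6)`-class of its typed Weil span) there is a PRODUCT ANCHOR `P = W₁ × W₂ × W₃`
(`ℚ(√-7)`-Weil fourfolds with ample compatible invertible `Lᵢ`, `hᵢ = ch₁ Lᵢ`; chosen with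
`det H₁ · det H₂ · det H₃ ≡ det H_A mod Nm(K^×)` — every `a ∈ ℚ_{>0}` is a fourfold discriminant,
van Geemen 5.4–5.8) such that for every finite locally free `F` on `P` with clean Chern data there are:
a smooth projective family `f : 𝒳 ⟶ B` over a smooth irreducible quasi-projective `B` (the universal
family of the PEL type of `(P, ψ₁×ψ₂×ψ₃, L₁⊠L₂⊠L₃)` with level `N ≥ 3`: Baily–Borel, Mumford; the level
makes the `{±1} = O_K^{×,Nm=1}`-valued `det`-monodromy on `⋀¹²_K` trivial), a point `b₀` with
`𝒳_{b₀} ≅ P`, flat Hodge sections `τ k` through `ch_k(F)` (polarisation powers; in degree 12 also the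
rational Weil section: a flat rank-2 `ℚ`-subsystem, of type `(6,6)` on EVERY fibre), and a point `b`
whose fibre is an abelian 12-fold `(A″, φ″)`, `φ″ ≫ φ″ = -7`, `K`-ISOGENOUS to `(A, φ)` in the tree's
sense (`f₁ : A ⟶ A″` flat, `g₁ : A″ ⟶ A` `K`-equivariant, `f₁ ≫ g₁ = m·𝟙`, `m ≥ 1`: Landherr's
classification — same signature `(6,6)` and same `det H` ⟹ `H₁(A,ℚ) ≅ H₁(P,ℚ)` as `K`-Hermitian
spaces — then re-latticing `A` to the integral type of `P`, van Geemen 3.6 / Markman §11.5 Step 1), at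
which `τ 6 b` reads `η + v₊ + v₋` on `A″`: `η` algebraic (`R h″⁶/6!`) and `v±` in the two typed
eigenspaces of `(A″, φ″)`, BOTH NON-ZERO (flat transport inside the two Weil line sub-systems).
[informal size XL (PEL moduli, universal families, Künneth/monodromy bookkeeping); classically known] -/
def ProductAnchoredFamilies : Prop :=
  ∃ C : ChernCharacterBetti,
    ∀ (A : AbelianVariety ℂ) (φ : A ⟶ A), A.dim = 12 → φ ≫ φ = -((7 : ℤ) • 𝟙 A) →
      Witness[A, φ, 12, 6] →
    ∃ (W₁ W₂ W₃ : AbelianVariety ℂ) (ψ₁ : W₁ ⟶ W₁) (ψ₂ : W₂ ⟶ W₂) (ψ₃ : W₃ ⟶ W₃)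
      (L₁ : W₁.X.left.Modules) (L₂ : W₂.X.left.Modules) (L₃ : W₃.X.left.Modules)
      (h₁ : complexBetti W₁.X 2) (h₂ : complexBetti W₂.X 2) (h₃ : complexBetti W₃.X 2),
      Fourfold[C, W₁, ψ₁, L₁, h₁] ∧ Fourfold[C, W₂, ψ₂, L₂, h₂] ∧ Fourfold[C, W₃, ψ₃, L₃, h₃] ∧
    ∀ (F : (P3[W₁, W₂, W₃]).X.left.Modules) (_ : IsFiniteLocallyFree F) (R : ℕ),
      Clean[C, P3[W₁, W₂, W₃], E3[W₁, W₂, W₃, ψ₁, ψ₂, ψ₃], H3[W₁, W₂, W₃, h₁, h₂, h₃], F, R] →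
    ∃ (𝒳 B : SchemeOver ℂ) (f : 𝒳 ⟶ B) (_ : Family[f, B])
      (b₀ : ComplexPoints B) (e₀ : fiberOver f b₀ ≅ (P3[W₁, W₂, W₃]).X)
      (τ : ∀ (k : ℕ) (s : ComplexPoints B), complexBetti (fiberOver f s) (2 * k)),
      FlatHodge[f, τ] ∧
      (∀ k : ℕ, τ k b₀ = complexBetti.map e₀.hom (2 * k)
        (ChernCharacterBetti.ch C (P3[W₁, W₂, W₃]).X F k)) ∧
    ∃ (A'' : AbelianVariety ℂ) (φ'' : A'' ⟶ A'') (f₁ : A ⟶ A'') (g₁ : A'' ⟶ A) (m : ℕ),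
      A''.dim = 12 ∧ φ'' ≫ φ'' = -((7 : ℤ) • 𝟙 A'') ∧ Flat f₁.hom.hom.hom.left ∧ 0 < m ∧
      f₁ ≫ g₁ = m • 𝟙 A ∧ g₁ ≫ φ = φ'' ≫ g₁ ∧
    ∃ (b : ComplexPoints B) (e : fiberOver f b ≅ A''.X) (η vp vm : complexBetti A''.X 12),
      η ∈ algebraicClasses A''.X 6 ∧ vp ∈ EigP[A'', φ'', 12] ∧ vm ∈ EigM[A'', φ'', 12] ∧
      vp ≠ 0 ∧ vm ≠ 0 ∧ complexBetti.map e.inv (2 * 6) (τ 6 b) = η + vp + vm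

/-- **Statement 6 (`stub_algebraicitySpreads`) — algebraicity of a flat class spreads from an étale-local family of bundles
(classical; L/XL in Lean).** Let `f : 𝒳 ⟶ B` be a smooth projective family of `n`-folds over an
irreducible quasi-projective complex base, `τ` a continuous (= flat) section of the étalé space of
`R^{2p} f_* ℂ`, `g : V ⟶ B` DOMINANT from an irreducible quasi-projective `V`, `𝒳' = 𝒳 ×_B V` with
its family `f'` and fibre identifications `𝒳'_v ≅ 𝒳_{g v}` compatible with `G : 𝒳' ⟶ 𝒳`, and `𝓖` a
finite locally free sheaf on `𝒳'` whose restriction to ONE fibre `𝒳'_{v₀}` has `ch_p = τ (g v₀)`.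
Then `τ s` is an algebraic class of `𝒳_s` for EVERY `s ∈ B(ℂ)`.  Proof: `v ↦ ch_p(𝓖|_{𝒳'_v}) =
(ch_p 𝓖)|_{𝒳'_v}` (`ChernCharacterBetti.map_ch`) is the continuous `globalSection` of a global class,
`v ↦ τ (g v)` transported along the cartesian square is continuous, they agree at `v₀`, `V(ℂ)` is
connected and `FiberClass` is a covering space ⟹ they agree on `V(ℂ)`, so `τ` is algebraic
(`ch_mem_algebraicClasses`, transport along `𝒳'_v ≅ 𝒳_{g v}`) on the fibres over `g(V(ℂ))`, which
contains a non-empty Zariski-open `U(ℂ)` (Chevalley); the set of `s` with `τ s` algebraic is a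
countable union of Zariski-closed sets (relative Chow schemes of `f`: on each connected component of
`Chow(ℂ)` a flat section either agrees with the cycle-class section everywhere or nowhere), and a
non-empty open of the irreducible `B(ℂ)` is not covered by countably many proper closed subsets
(Baire) ⟹ all of `B(ℂ)`. [cite: Voisin2007HodgeLoci, §1 (algebraicity along the Hodge locus)]
[informal size L classically, XL formally] -/
def AlgebraicitySpreads : Prop :=
  ∀ (C : ChernCharacterBetti) (n p : ℕ) (𝒳 B : SchemeOver ℂ) (f : 𝒳 ⟶ B),
      IsSmoothProjectiveFamily f n → IsQuasiProjectiveOver B → IsIntegral B.left →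
    ∀ (τ : ∀ s : ComplexPoints B, complexBetti (fiberOver f s) (2 * p)),
      Continuous (fun s => (⟨s, τ s⟩ : FiberClass f (2 * p))) →
    ∀ (V 𝒳' : SchemeOver ℂ) (g : V ⟶ B) (f' : 𝒳' ⟶ V) (G : 𝒳' ⟶ 𝒳),
      IsQuasiProjectiveOver V → IsIntegral V.left → IsDominant g.left → IsPullback G f' f g →
      IsSmoothProjectiveFamily f' n →
    ∀ (e : ∀ v : ComplexPoints V, fiberOver f' v ≅ fiberOver f (v ≫ g)),
      (∀ v, (e v).hom ≫ fiberι f (v ≫ g) = fiberι f' v ≫ G) →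
    ∀ (𝓖 : 𝒳'.left.Modules), IsFiniteLocallyFree 𝓖 →
    ∀ (v₀ : ComplexPoints V),
      ChernCharacterBetti.ch C (fiberOver f' v₀) ((Scheme.Modules.pullback (fiberι f' v₀).left).obj 𝓖) p =
        complexBetti.map (e v₀).hom (2 * p) (τ (v₀ ≫ g)) →
    ∀ s : ComplexPoints B, τ s ∈ algebraicClasses (fiberOver f s) p

/-- **Statement 7 (`stub_typedPlaneTransfer`) — typed Weil-plane saturation and isogeny transfer (L).** Let `(A, φ)` and `(A″, φ″)`
be complex abelian 12-folds with `φ² = φ″² = -7` and an isogeny pair `f₁ : A ⟶ A″` (flat),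
`g₁ : A″ ⟶ A` `K`-equivariant (`g₁ ≫ φ = φ″ ≫ g₁`), `f₁ ≫ g₁ = m·𝟙_A`, `m ≥ 1` (the tree's isogeny
shape, `WeilClassesIsogenyDescent`).  If ONE class `v₊ + v₋` with `v₊ ∈ Eig((𝟙+φ″)^*, (1+i√7)¹²)`,
`v₋ ∈ Eig((𝟙+φ″)^*, (1-i√7)¹²)` BOTH NON-ZERO is algebraic on `A″`, then EVERY class of the typed Weil
span of `(A, φ)` is algebraic.  Proof: `(𝟙+φ″)^*` preserves `N⁶H¹²` (flat pull-back along an isogeny)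
and has eigenvalues `λ = (1+i√7)¹² ≠ λ̄` on `v±` (`Negative.weilEigenvalues_twelve_ne`), so `v₊`, `v₋`
are algebraic (`mem_and_mem_of_smul_add_smul_mem`); the typed eigenspaces of a 12-fold are LINES
(`H¹²(A″) = ⋀¹²H¹`, `(x𝟙+yφ)^*` acts on `⋀ᵃV₊ ⊗ ⋀ᵇV₋` by `(x+iy√7)ᵃ(x-iy√7)ᵇ`, `Negative.mixed_twelve`:
only `(a,b) = (12,0), (0,12)` give `λ, λ̄`), hence spanned by `v±`; for `c` in the typed span of `A`,
`g₁^* c` lies in the typed span of `A″` (intertwining), so is algebraic, and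
`f₁^* g₁^* c = (m·𝟙)^* c = m¹² c` is algebraic on `A` (`map_mem_algebraicClasses_of_flat`; `[m]^* = mᵏ`
on `Hᵏ` of an abelian variety). [informal size L (needs `H* = ⋀*H¹` on the real carriers)] -/
def TypedPlaneTransfer : Prop :=
  ∀ (A A'' : AbelianVariety ℂ) (φ : A ⟶ A) (φ'' : A'' ⟶ A''), A.dim = 12 → A''.dim = 12 →
      φ ≫ φ = -((7 : ℤ) • 𝟙 A) → φ'' ≫ φ'' = -((7 : ℤ) • 𝟙 A'') →
    ∀ (f₁ : A ⟶ A'') (g₁ : A'' ⟶ A) (m : ℕ), Flat f₁.hom.hom.hom.left → 0 < m →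
      f₁ ≫ g₁ = m • 𝟙 A → g₁ ≫ φ = φ'' ≫ g₁ →
    ∀ (vp vm : complexBetti A''.X 12), vp ∈ EigP[A'', φ'', 12] → vm ∈ EigM[A'', φ'', 12] →
      vp ≠ 0 → vm ≠ 0 → vp + vm ∈ algebraicClasses A''.X 6 →
    ∀ c : complexBetti A.X 12, c ∈ EigP[A, φ, 12] ⊔ EigM[A, φ, 12] → c ∈ algebraicClasses A.X 6

/-! ### The seven registered stubs (the ONLY `sorry`s of the line) -/

/-- Stub 1 (M, provable now): the Poincaré–Pólya positive multiplier theorem. -/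
theorem stub_polyaMultiplier : PolyaMultiplier := by
  sorry

/-- Stub 2 (M/L): Markman 2025 for `ℚ(√-7)` fourfolds in the route's typing. -/
theorem stub_weilFourfoldsTyped : WeilFourfoldsTyped := by
  sorry

/-- Stub 3 (L): the Pólya bundle on every product anchor, given Stubs 1–2. -/
theorem stub_polyaBundle : PolyaBundle := by
  sorry

/-- Stub 4 (XL, THE BET): the glued Pólya bundle extends over a dominant base change. -/
theorem stub_gluedBundleExtends : GluedBundleExtends := by
  sorry

/-- Stub 5 (XL, classical): product-anchored polarised Weil families reach every Weil 12-fold up to isogeny. -/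
theorem stub_productAnchoredFamilies : ProductAnchoredFamilies := by
  sorry

/-- Stub 6 (L/XL, classical): algebraicity of a flat class spreads from an étale-local family of bundles. -/
theorem stub_algebraicitySpreads : AlgebraicitySpreads := by
  sorry

/-- Stub 7 (L): typed Weil-plane saturation and isogeny transfer. -/
theorem stub_typedPlaneTransfer : TypedPlaneTransfer := by
  sorry

/-! ### Name-keyed aliases of the seven statements (the hypotheses of the composition; the tree's
skeleton convention: hypotheses of `_of` are exactly the registered stubs, each by name) -/
namespace Registered

/-- Alias of `PolyaMultiplier` keyed by the registered stub name. -/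
abbrev stub_polyaMultiplier : Prop := PolyaMultiplier
/-- Alias of `WeilFourfoldsTyped` keyed by the registered stub name. -/
abbrev stub_weilFourfoldsTyped : Prop := WeilFourfoldsTyped
/-- Alias of `PolyaBundle` keyed by the registered stub name. -/
abbrev stub_polyaBundle : Prop := PolyaBundle
/-- Alias of `GluedBundleExtends` keyed by the registered stub name. -/
abbrev stub_gluedBundleExtends : Prop := GluedBundleExtends
/-- Alias of `ProductAnchoredFamilies` keyed by the registered stub name. -/
abbrev stub_productAnchoredFamilies : Prop := ProductAnchoredFamilies
/-- Alias of `AlgebraicitySpreads` keyed by the registered stub name. -/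
abbrev stub_algebraicitySpreads : Prop := AlgebraicitySpreads
/-- Alias of `TypedPlaneTransfer` keyed by the registered stub name. -/
abbrev stub_typedPlaneTransfer : Prop := TypedPlaneTransfer

end Registered

/-! ### The composition (concludes the crux BY NAME; sorry-free glue) -/

/-- **`WeilTwelvefoldsSqrtMinus7` from the seven stubs.**  Given a 12-fold `(A, φ)` and a rational
`(6,6)` class `c` of its typed Weil span: if `c = 0` it is algebraic.  Otherwise `c` witnesses Weil type;
Stub 5 gives the Chern character theory `C`, a product anchor `P` with its data, and — for the clean
non-degenerate bundle `F` on `P` delivered by Stub 3 (fed Stubs 1, 2) — the family `f : 𝒳 ⟶ B` through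
`P` with flat Hodge sections `τ` through `ch F`, and the `K`-isogenous fibre `(A″, φ″)` over `b` where
`τ 6 b` reads `η + v₊ + v₋`.  Stub 4 extends (a replacement of) `F` to a bundle `𝓖` over a dominant
base change; Stub 6 spreads: `τ 6 b` is algebraic on `𝒳_b`; transport along `𝒳_b ≅ A″`
(`map_mem_algebraicClasses_of_isOpenImmersion`), subtract the algebraic `η`: `v₊ + v₋` is algebraic on
`A″`; Stub 7 transfers to every class of the typed span of `A`, in particular `c`. -/
theorem WeilTwelvefoldsSqrtMinus7_of
    (h₁ : Registered.stub_polyaMultiplier) (h₂ : Registered.stub_weilFourfoldsTyped)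
    (h₃ : Registered.stub_polyaBundle) (h₄ : Registered.stub_gluedBundleExtends)
    (h₅ : Registered.stub_productAnchoredFamilies) (h₆ : Registered.stub_algebraicitySpreads)
    (h₇ : Registered.stub_typedPlaneTransfer) :
    Summit.HodgeConjecture.HodgeConjecture.Theses.HeckePrymWeil.WeilTwelvefoldsSqrtMinus7 := by
  intro A φ hA hφ c hrat hH hW
  by_cases hc : c = 0
  · rw [hc]
    exact Submodule.zero_mem _
  obtain ⟨C, hC⟩ := h₅
  obtain ⟨W₁, W₂, W₃, ψ₁, ψ₂, ψ₃, L₁, L₂, L₃, k₁, k₂, k₃, hF₁, hF₂, hF₃, hreach⟩ :=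
    hC A φ hA hφ ⟨c, hc, hrat, hH, hW⟩
  obtain ⟨F, hF, R, -, hclean⟩ := h₃ h₁ h₂ C W₁ W₂ W₃ ψ₁ ψ₂ ψ₃ L₁ L₂ L₃ k₁ k₂ k₃ hF₁ hF₂ hF₃
  obtain ⟨𝒳, B, f, hfam, b₀, e₀, τ, hτ, hτ₀, A'', φ'', f₁, g₁, m, hA'', hφ'', hflat, hm, hfg, hg,
    b, e, η, vp, vm, hη, hvp, hvm, hvp0, hvm0, hτb⟩ := hreach F hF R hclean
  obtain ⟨V, 𝒳', g, f', G, hV₁, hV₂, -, hdom, hpb, hf', ev, v₀, 𝓖, h𝓖, hev, -, hanchor⟩ :=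
    h₄ C W₁ W₂ W₃ ψ₁ ψ₂ ψ₃ L₁ L₂ L₃ k₁ k₂ k₃ hF₁ hF₂ hF₃ F hF R hclean 𝒳 B f hfam b₀ e₀ τ hτ hτ₀
  -- Stub 6: the flat degree-12 section is algebraic on every fibre, in particular over `b`
  have halg : τ 6 b ∈ algebraicClasses (fiberOver f b) 6 :=
    h₆ C 12 6 𝒳 B f hfam.1 hfam.2.1 hfam.2.2.1 (τ 6) (hτ.1 6) V 𝒳' g f' G hV₁ hV₂ hdom hpb hf' ev hev
      𝓖 h𝓖 v₀ (hanchor 6) b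
  -- transport along the iso `e : 𝒳_b ≅ A″.X` and subtract the algebraic class `η`
  have halg' : complexBetti.map e.inv (2 * 6) (τ 6 b) ∈ algebraicClasses A''.X 6 :=
    map_mem_algebraicClasses_of_isOpenImmersion (hfam.1.isSmoothProjective b) e.inv halg
  rw [hτb] at halg'
  have hsum : vp + vm ∈ algebraicClasses A''.X 6 := by
    have h := (algebraicClasses A''.X 6).sub_mem halg' hη
    rwa [show η + vp + vm - η = vp + vm by abel] at h
  exact h₇ A A'' φ φ'' hA hA'' hφ hφ'' f₁ g₁ m hflat hm hfg hg vp vm hvp hvm hvp0 hvm0 hsum c hW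

/-- The crux from the stubs as they stand (depends on their `sorry`s; shows the composition closes). -/
theorem WeilTwelvefoldsSqrtMinus7_of_stubs :
    Summit.HodgeConjecture.HodgeConjecture.Theses.HeckePrymWeil.WeilTwelvefoldsSqrtMinus7 :=
  WeilTwelvefoldsSqrtMinus7_of stub_polyaMultiplier stub_weilFourfoldsTyped stub_polyaBundle
    stub_gluedBundleExtends stub_productAnchoredFamilies stub_algebraicitySpreads
    stub_typedPlaneTransfer

/-! ### Calibration examples (landed Negative lemmas this line answers to) -/

/-- The two typed eigenvalues of the crux differ: the `λ ≠ λ̄` step of Stub 7 (landed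
`Negative/EigenvalueTyping`, p72941). -/
example : (1 + Complex.I * ((Real.sqrt (7 : ℝ) : ℝ) : ℂ)) ^ 12 ≠
    (1 - Complex.I * ((Real.sqrt (7 : ℝ) : ℝ) : ℂ)) ^ 12 :=
  Summit.HodgeConjecture.HodgeConjecture.Theorems.WeilTwelvefoldsSqrtMinus7.Negative.weilEigenvalues_twelve_ne

/-- The bad Pólya characters are non-real: `(σ(k)/σ̄(k))^{4|a-b|} ≠ 1` for `a ≠ b`, `k = 1 + φ`
(Stub 3; landed `Negative.one_add_I_sqrt7_pow_ne`). -/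
example (a b : ℕ) (hab : a ≠ b) :
    (1 + Complex.I * ((Real.sqrt (7 : ℝ) : ℝ) : ℂ)) ^ (4 * (max a b - min a b)) ≠
      (1 - Complex.I * ((Real.sqrt (7 : ℝ) : ℝ) : ℂ)) ^ (4 * (max a b - min a b)) :=
  Summit.HodgeConjecture.HodgeConjecture.Theorems.WeilTwelvefoldsSqrtMinus7.Negative.one_add_I_sqrt7_pow_ne
    _ (by omega)

end Summit.HodgeConjecture.HodgeConjecture.Cruxes.WeilTwelvefoldsSqrtMinus7.PolyaGluedBoxProducts

end
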